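import Summits.ResolutionOfSingularities.ResolutionOfSingularities.Theorems.WeightedInvariantWeightedThesisHypersurfaceTowerRegular
import Summits.ResolutionOfSingularities.ResolutionOfSingularities.Theorems.WeightedInvariantWeightedThesisHypersurfaceTowerStep
import Summits.ResolutionOfSingularities.ResolutionOfSingularities.Theorems.WeightedInvariantWeightedThesisHypersurfacePreserved
import Summits.ResolutionOfSingularities.ResolutionOfSingularities.Theorems.WeightedInvariantWeightedThesisTowerGenericQuotient
import Summits.ResolutionOfSingularities.ResolutionOfSingularities.Theorems.WeightedInvariantWeightedThesisHypersurfacesIff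
import Summits.ResolutionOfSingularities.ResolutionOfSingularities.Theorems.WeightedInvariantWeightedThesisBerghRydhCharP
import Summits.ResolutionOfSingularities.ResolutionOfSingularities.Theorems.WeightedInvariantDatumToEmbedded
import HarnessLib

/-!
# Crux `WeightedThesis` (stmt-ResolutionOfSingularities-0569): a HYPERSURFACE datum suffices

Topic: `Summits/ResolutionOfSingularities/ResolutionOfSingularities/Theorems`. Route
`ResolutionOfSingularities/WeightedInvariant`, crux `Theses.WeightedInvariant.WeightedThesis` (resolution
of every reduced separated scheme of finite type over every PERFECT field of characteristic `p`, every
prime `p`), line `datum-glued-split`, lead c7, RESHAPE 7 — the ASSEMBLY.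

The route derives the crux from the construction crux `WeightedConstruction` (stmt-0571,
`∀ p prime, Nonempty (WeightedResolutionDatum p)`) through Włodarczyk's cobordant tower (crux 0572,
`Theorems/WeightedInvariantDatumToEmbedded*.lean`) and Bergh–Rydh's theorem. The line showed that the
datum is only ever consumed on INTEGRAL HYPERSURFACES (`weightedThesis_iff_hypersurfaces`, p148806) and
that the tower never leaves that class (`…HypersurfacePreserved`, this lead). This file runs the tower
with the WEAKER interface `HypersurfaceResolutionDatum p` (`Theorems/…HypersurfaceDatum.lean`: the
datum's axioms demanded only on pairs `(Y, X)` with `X` locally principal and `X.subscheme` integral)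
— door (α) of the construction crux's strategy census
(`Cruxes/WeightedConstruction/STRATEGY-CENSUS.md` §6):

* `HypersurfaceTower.hasResolution_quotient_of_gradedAtlas` — the well-founded induction on `max inv`
  over HYPERSURFACE pairs (`HypersurfaceTower.maxinv_induction`): base = the resolved case + quotient
  singularities + Bergh–Rydh over `k`; step = the datum-free tower lemmas for the centre
  `D.centre f (ker i)` (`…TowerGenericAmbient`, `…TowerGenericQuotient`: ambient, strict transform,
  quotient step) with `hc` from axiom `(iii)` and `hξ` from `(ii)`+`(iii)`
  (`genericPoint_not_mem_support_centre`), homogeneity and drop for the hypersurface datum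
  (`…HypersurfaceTowerStep`), and the successor pair again a hypersurface pair
  (`isLocallyPrincipal_strictTransformPlus`, integrality of the strict transform);
* `HypersurfaceTower.hasResolution_hypersurface_of_hypersurfaceDatum_field` — hence a hypersurface datum
  in characteristic `p` plus Bergh–Rydh over the perfect field `k` of characteristic `p` resolve every
  integral hypersurface of every smooth separated quasi-compact `k`-scheme;
* `HypersurfaceTower.hasResolution_of_hypersurfaceDatum_field` — and every reduced separated `k`-scheme
  of finite type (`HypersurfacesIff.hasResolution_of_hypersurfaces`: projective reduction, hypersurface
  models, finite birational transfer);
* `HypersurfaceTower.resolution_field_iff_berghRydh_field_of_hypersurfaceDatum` — given a hypersurface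
  datum at `p = char k`, resolution over `k` ⟺ Bergh–Rydh over `k`;
* `weightedThesis_of_hypersurfaceConstruction_of_forall_berghRydh_charP` (registered stub of the line) —
  **`(∀ p prime, Nonempty (HypersurfaceResolutionDatum p))` and the characteristic-`p` instances of
  Bergh–Rydh give `WeightedThesis`**; fed with `HypersurfaceResolutionDatum.ofDatum` it is
  `weightedThesis_of_forall_berghRydh_charP` (the RESHAPE 6 residue) from a strictly weaker first input.
-/

noncomputable section

open CategoryTheory CategoryTheory.Limits AlgebraicGeometry TopologicalSpace
open Literature.AlgebraicGeometry.Resolution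
open Summit.ResolutionOfSingularities.ResolutionOfSingularities.Theses.WeightedInvariant
open Summit.ResolutionOfSingularities.ResolutionOfSingularities.Theorems

set_option linter.dupNamespace false -- mandated namespace of this single-conjunct summit

namespace Summit.ResolutionOfSingularities.ResolutionOfSingularities.Theorems.HypersurfaceTower

/-! ## The tower over hypersurface pairs, with Bergh–Rydh over one field -/

/-- **Every torus-quotient presentation of an integral hypersurface of `Y/k` has a resolved quotient,
granted a hypersurface datum at `p = char k` and Bergh–Rydh over `k`**: the well-founded induction on
`max inv` of `DatumToEmbedded.hasResolution_quotient_of_gradedAtlas`, run over HYPERSURFACE pairs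
(`maxinv_induction`) with the datum-free tower lemmas for the datum's centre (base: `X` regular ⇒ the
quotient has finite diagonalizable quotient singularities étale-locally, resolved by the hypothesis;
step: global cobordant blow-up, quotient step, transport along the blow-up downstairs; the successor
pair `(B₊, σˢ(ker i)|_{B₊})` is a hypersurface pair by `isLocallyPrincipal_strictTransformPlus` and the
integrality of the strict transform). [cite: Wlodarczyk2022, Thm 1.1.4 (5), Thm 1.1.6; BerghRydh2019, Thm 5] -/
theorem hasResolution_quotient_of_gradedAtlas
    {p : ℕ} (D : HypersurfaceResolutionDatum p) {k : Type} [Field k] [CharP k p] [PerfectField k]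
    (hBR : ∀ (V : Scheme.{0}) (g : V ⟶ Spec (.of k)) [IsIntegral V] [IsSeparated g]
      [LocallyOfFiniteType g] [QuasiCompact g],
      (∀ v : V, ∃ (A : Type) (_ : AddCommGroup A) (_ : Finite A) (_ : DecidableEq A)
        (S : Type) (_ : CommRing S) (_ : Algebra k S) (𝒮 : A → Submodule k S)
        (_ : GradedAlgebra 𝒮), Algebra.FiniteType k S ∧ Algebra.Smooth k S ∧
        ∃ φ : Spec (.of (𝒮 0)) ⟶ V, Etale φ ∧ v ∈ Set.range φ ∧
          φ ≫ g = Spec.map (CommRingCat.ofHom (algebraMap k (𝒮 0)))) →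
      Scheme.HasResolution V)
    (Y : Scheme.{0}) (f : Y ⟶ Spec (.of k)) [Smooth f] [IsSeparated f] [QuasiCompact f]
    (I : Y.IdealSheafData) (hI : IsLocallyPrincipal I) (hIi : IsIntegral I.subscheme) :
    ∀ (X V : Scheme.{0}) (i : X ⟶ Y) [IsClosedImmersion i] [IsIntegral X], i.ker = I →
      ∀ (g : V ⟶ Spec (.of k)) [IsSeparated g] [LocallyOfFiniteType g] [QuasiCompact g]
        [IsIntegral V] (q : X ⟶ V), q ≫ g = i ≫ f → ∀ (j : ℕ), GradedAtlas j f i q →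
        Scheme.HasResolution V := by
  have key := maxinv_induction D
    (fun (Y : Scheme.{0}) (f : Y ⟶ Spec (.of k)) (I : Y.IdealSheafData) =>
      ∀ [Smooth f] [IsSeparated f] [QuasiCompact f] (X V : Scheme.{0}) (i : X ⟶ Y)
        [IsClosedImmersion i] [IsIntegral X], i.ker = I →
        ∀ (g : V ⟶ Spec (.of k)) [IsSeparated g] [LocallyOfFiniteType g] [QuasiCompact g]
          [IsIntegral V] (q : X ⟶ V), q ≫ g = i ≫ f → ∀ (j : ℕ), GradedAtlas j f i q →
          Scheme.HasResolution V) ?base ?step Y f I hI hIi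
  · exact fun X V i _ _ hIeq g _ _ _ _ q hq j 𝒜 => key X V i hIeq g q hq j 𝒜
  · -- base: `inv` everywhere minimal ⇒ `X` regular ⇒ quotient singularities ⇒ Bergh–Rydh over `k`
    intro Y f _ _ _ I hI hIi hbot _ _ _ X V i _ _ hIeq g _ _ _ _ q hq j 𝒜
    subst hIeq
    have hreg : Scheme.IsRegular X := isRegular_of_forall_inv_isBot D f i hI hIi hbot
    exact hBR V g (DatumToEmbedded.quotientSingularities_of_regular f i q g hq hreg 𝒜)
  · -- step
    intro Y f _ _ _ I y₀ hI hIi hy₀ hmax ih _ _ _ X V i _ _ hIeq g _ _ _ _ q hq j 𝒜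
    subst hIeq
    have hguard : ∃ y : Y, ¬ IsBot (D.inv f i.ker y) := ⟨y₀, hy₀⟩
    haveI : IsLocallyNoetherian Y := LocallyOfFiniteType.isLocallyNoetherian f
    have hY : Scheme.IsRegular Y := Scheme.IsRegular.of_smooth f (Scheme.isRegular_Spec (.of k))
    -- the datum's centre is a regular weighted centre missing the generic point of `X`
    have hc : (D.centre f i.ker).IsRegularWeightedCentre :=
      D.isRegularWeightedCentre_centre f i.ker hI hIi hguard
    have hξ : i (genericPoint X) ∉ (D.centre f i.ker).support :=
      genericPoint_not_mem_support_centre D f i hI hIi hguard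
    -- the Rees filtration of the centre
    let R' : ReesFiltration Y :=
      { ideal := (D.centre f i.ker).piece
        ideal_zero := (D.centre f i.ker).piece_zero
        antitone := antitone_piece hc
        mul_le := (D.centre f i.ker).piece_mul_le }
    -- the new ambient is smooth separated quasi-compact
    obtain ⟨hsm', hsep', hqc'⟩ :=
      WeightedThesis.GlobalCobordantPlus.smooth_πPlus_comp_of_isRegularWeightedCentre f
        (D.centre f i.ker) hc R' rfl
    haveI := hsm'; haveI := hsep'; haveI := hqc'
    -- the strict transform is integral and lies over `X`
    obtain ⟨hint', hker⟩ :=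
      DatumToEmbedded.StrictTransform.isIntegral_strictTransformPlus_of_not_mem_support i
        (D.centre f i.ker) hc R' rfl hξ
    haveI := hint'
    set I' := R'.strictTransformPlus i.ker with hI'
    -- the successor pair is a hypersurface pair
    have hI'lp : IsLocallyPrincipal I' :=
      WeightedThesis.HypersurfacePreserved.isLocallyPrincipal_strictTransformPlus hY
        (D.centre f i.ker) hc R' rfl i.ker hI
    have hI'i : IsIntegral I'.subscheme := hint'
    let i' := I'.subschemeι
    let σX : I'.subscheme ⟶ X := IsClosedImmersion.lift i (i' ≫ R'.πPlus) hker
    have hσX : σX ≫ i = i' ≫ R'.πPlus := IsClosedImmersion.lift_fac _ _ _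
    -- homogeneity of the centre on the charts, then the quotient step
    have hhom := fun (a : 𝒜.ι) (n : ℕ) =>
      @DatumToEmbedded.CentreHomogeneous.centre_isHomogeneous_of_hypersurfaceDatum p D k _ _ _ Y f
        _ _ _ i.ker hI hIi hguard j (𝒜.W a) (𝒜.piece a) (𝒜.gradedRing a) (𝒜.appLE_mem a)
        (𝒜.isHomogeneous_ker a) n
    obtain ⟨K, hK, hstep⟩ := DatumToEmbedded.quotientStep_of_isRegularWeightedCentre f i q g hq 𝒜
      (D.centre f i.ker) hc hξ hhom R' rfl σX hσX
    -- blow `V` up along `K`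
    obtain ⟨V', ρ, hρ⟩ := exists_isBlowup V K
    haveI : IsLocallyNoetherian V := LocallyOfFiniteType.isLocallyNoetherian g
    haveI : IsProper ρ := hρ.isProper
    have hbir : IsBirational ρ := hρ.isBirational' hK
    haveI : IsIntegral V' := hρ.isIntegral hK
    obtain ⟨q', hq', ⟨𝒜'⟩⟩ := hstep V' ρ hρ
    -- the drop of `max inv`, and the induction hypothesis resolves `V'`
    have hdrop := DatumToEmbedded.InvDrop.inv_drop_of_hypersurfaceDatum D f i.ker hI hIi hguard y₀
      hmax R' rfl hI'lp hI'i
    have hV' : Scheme.HasResolution V' := by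
      have hQ' := ih (R'.plus : Scheme.{0}) (R'.πPlus ≫ f) I' hI'lp hI'i hdrop
      refine hQ' I'.subscheme V' i' (Scheme.IdealSheafData.ker_subschemeι I') (ρ ≫ g) q' ?_
        (j + 1) 𝒜'
      rw [← Category.assoc, hq', Category.assoc, hq, ← Category.assoc, hσX, Category.assoc]
    exact Scheme.HasResolution.of_isBirational ρ hbir hV'

/-! ## Hypersurface datum + Bergh–Rydh over `k` ⇒ resolution over `k` -/

/-- **A hypersurface datum in characteristic `p` and Bergh–Rydh over the perfect field `k` of
characteristic `p` resolve every integral HYPERSURFACE of every smooth separated quasi-compact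
`k`-scheme** (run `hasResolution_quotient_of_gradedAtlas` on the trivial presentation `q = 𝟙 X` of rank
`0`, `DatumToEmbedded.InitialAtlas.stub_initialAtlas`). [cite: Wlodarczyk2022, Thm 1.1.6; BerghRydh2019, Thm 5] -/
theorem hasResolution_hypersurface_of_hypersurfaceDatum_field
    {p : ℕ} (D : HypersurfaceResolutionDatum p) {k : Type} [Field k] [CharP k p] [PerfectField k]
    (hBR : ∀ (V : Scheme.{0}) (g : V ⟶ Spec (.of k)) [IsIntegral V] [IsSeparated g]
      [LocallyOfFiniteType g] [QuasiCompact g],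
      (∀ v : V, ∃ (A : Type) (_ : AddCommGroup A) (_ : Finite A) (_ : DecidableEq A)
        (S : Type) (_ : CommRing S) (_ : Algebra k S) (𝒮 : A → Submodule k S)
        (_ : GradedAlgebra 𝒮), Algebra.FiniteType k S ∧ Algebra.Smooth k S ∧
        ∃ φ : Spec (.of (𝒮 0)) ⟶ V, Etale φ ∧ v ∈ Set.range φ ∧
          φ ≫ g = Spec.map (CommRingCat.ofHom (algebraMap k (𝒮 0)))) →
      Scheme.HasResolution V)
    {Y X : Scheme.{0}} (f : Y ⟶ Spec (.of k)) [Smooth f] [IsSeparated f] [QuasiCompact f]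
    (i : X ⟶ Y) [IsClosedImmersion i] [IsIntegral X] (hX : IsLocallyPrincipal i.ker) :
    Scheme.HasResolution X := by
  obtain ⟨𝒜₀⟩ := DatumToEmbedded.InitialAtlas.stub_initialAtlas f i
  haveI : IsSeparated (i ≫ f) := inferInstance
  haveI : LocallyOfFiniteType (i ≫ f) := inferInstance
  haveI : QuasiCompact (i ≫ f) := inferInstance
  exact hasResolution_quotient_of_gradedAtlas D hBR Y f i.ker hX (isIntegral_ker_subscheme i) X X i rfl
    (i ≫ f) (𝟙 X) (Category.id_comp _) 0 𝒜₀

/-- **A hypersurface datum in characteristic `p` and Bergh–Rydh over the perfect field `k` of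
characteristic `p` resolve every reduced separated `k`-scheme of finite type**
(`hasResolution_hypersurface_of_hypersurfaceDatum_field` spread by the hypersurface reduction
`HypersurfacesIff.hasResolution_of_hypersurfaces`: irreducible components, Chow's lemma, hypersurface
models by generic projection / graph closures, finite birational transfer).
[cite: Wlodarczyk2022, Thm 1.1.6; BerghRydh2019, Thm 5; Kollar2007, Prop. 2.48 (proof)] -/
theorem hasResolution_of_hypersurfaceDatum_field
    {p : ℕ} (hp : p.Prime) (D : HypersurfaceResolutionDatum p) {k : Type} [Field k] [CharP k p]
    [PerfectField k]
    (hBR : ∀ (V : Scheme.{0}) (g : V ⟶ Spec (.of k)) [IsIntegral V] [IsSeparated g]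
      [LocallyOfFiniteType g] [QuasiCompact g],
      (∀ v : V, ∃ (A : Type) (_ : AddCommGroup A) (_ : Finite A) (_ : DecidableEq A)
        (S : Type) (_ : CommRing S) (_ : Algebra k S) (𝒮 : A → Submodule k S)
        (_ : GradedAlgebra 𝒮), Algebra.FiniteType k S ∧ Algebra.Smooth k S ∧
        ∃ φ : Spec (.of (𝒮 0)) ⟶ V, Etale φ ∧ v ∈ Set.range φ ∧
          φ ≫ g = Spec.map (CommRingCat.ofHom (algebraMap k (𝒮 0)))) →
      Scheme.HasResolution V)
    (X : Scheme.{0}) (f : X ⟶ Spec (.of k)) [IsSeparated f] [LocallyOfFiniteType f]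
    [QuasiCompact f] [IsReduced X] : Scheme.HasResolution X :=
  Summit.ResolutionOfSingularities.ResolutionOfSingularities.Theorems.WeightedThesis.HypersurfacesIff.hasResolution_of_hypersurfaces hp k
    (fun Y H g j hg hs hq hj hint hpr => by
      haveI := hg; haveI := hs; haveI := hq; haveI := hj; haveI := hint
      exact hasResolution_hypersurface_of_hypersurfaceDatum_field D hBR g j
        (isLocallyPrincipal_of_forall_isPrincipal hpr)) X f

/-- **The field-wise residue of the crux with a HYPERSURFACE datum.** Over a perfect field `k` of
characteristic `p` carrying a hypersurface resolution datum `D : HypersurfaceResolutionDatum p`,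
resolution of every reduced separated `k`-scheme of finite type is EQUIVALENT to Bergh–Rydh's theorem
over `k` (`→` forgets the quotient charts; `←` is the hypersurface tower).
[cite: Wlodarczyk2022, Thm 1.1.6; BerghRydh2019, Thm 5] -/
theorem resolution_field_iff_berghRydh_field_of_hypersurfaceDatum
    {p : ℕ} (hp : p.Prime) (D : HypersurfaceResolutionDatum p) (k : Type) [Field k] [CharP k p]
    [PerfectField k] :
    (∀ (X : Scheme.{0}) (f : X ⟶ Spec (.of k)), IsSeparated f → LocallyOfFiniteType f →
      QuasiCompact f → IsReduced X → Scheme.HasResolution X) ↔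
    ∀ (V : Scheme.{0}) (g : V ⟶ Spec (.of k)) [IsIntegral V] [IsSeparated g]
      [LocallyOfFiniteType g] [QuasiCompact g],
      (∀ v : V, ∃ (A : Type) (_ : AddCommGroup A) (_ : Finite A) (_ : DecidableEq A)
        (S : Type) (_ : CommRing S) (_ : Algebra k S) (𝒮 : A → Submodule k S)
        (_ : GradedAlgebra 𝒮), Algebra.FiniteType k S ∧ Algebra.Smooth k S ∧
        ∃ φ : Spec (.of (𝒮 0)) ⟶ V, Etale φ ∧ v ∈ Set.range φ ∧
          φ ≫ g = Spec.map (CommRingCat.ofHom (algebraMap k (𝒮 0)))) →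
      Scheme.HasResolution V :=
  ⟨Summit.ResolutionOfSingularities.ResolutionOfSingularities.Theorems.WeightedThesis.BerghRydhCharP.berghRydh_field_of_resolution_field,
    fun hBR X f hs hl hq hr => by
    haveI := hs; haveI := hl; haveI := hq; haveI := hr
    exact hasResolution_of_hypersurfaceDatum_field hp D hBR X f⟩

end Summit.ResolutionOfSingularities.ResolutionOfSingularities.Theorems.HypersurfaceTower

namespace Summit.ResolutionOfSingularities.ResolutionOfSingularities.Theorems

/-! ## The crux from a hypersurface construction and prime-wise Bergh–Rydh -/

/-- **`WeightedThesis` from a HYPERSURFACE construction and the characteristic-`p` instances of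
Bergh–Rydh** (registered stub of line `datum-glued-split`, RESHAPE 7, crux stmt-0569): if for every
prime `p` a hypersurface resolution datum exists (`Nonempty (HypersurfaceResolutionDatum p)` — strictly
fewer obligations than the construction crux `WeightedConstruction`, which implies it through
`HypersurfaceResolutionDatum.ofDatum`), and for every prime `p` and every perfect field `k` of
characteristic `p` every integral separated finite-type `k`-scheme with finite diagonalizable quotient
singularities étale-locally has a resolution, then every reduced separated scheme of finite type over
every perfect field of positive characteristic has a resolution. Fed with `HypersurfaceResolutionDatum.ofDatum`
this is `WeightedThesis.BerghRydhCharP.weightedThesis_of_forall_berghRydh_charP` (the RESHAPE 6 residue) from a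
strictly weaker first input. [cite: Wlodarczyk2022, Thm 1.1.6; BerghRydh2019, Thm 5; AbramovichTemkinWlodarczyk2024, §1.9] -/
theorem weightedThesis_of_hypersurfaceConstruction_of_forall_berghRydh_charP : (∀ p : ℕ, p.Prime → Nonempty (Summit.ResolutionOfSingularities.ResolutionOfSingularities.Theorems.HypersurfaceResolutionDatum p)) → (∀ p : ℕ, p.Prime → ∀ (k : Type) [Field k] [CharP k p] [PerfectField k] (V : AlgebraicGeometry.Scheme.{0}) (g : V ⟶ AlgebraicGeometry.Spec (.of k)) [AlgebraicGeometry.IsIntegral V] [AlgebraicGeometry.IsSeparated g] [AlgebraicGeometry.LocallyOfFiniteType g] [AlgebraicGeometry.QuasiCompact g], (∀ v : V, ∃ (A : Type) (_ : AddCommGroup A) (_ : Finite A) (_ : DecidableEq A) (S : Type) (_ : CommRing S) (_ : Algebra k S) (𝒮 : A → Submodule k S) (_ : GradedAlgebra 𝒮), Algebra.FiniteType k S ∧ Algebra.Smooth k S ∧ ∃ φ : AlgebraicGeometry.Spec (.of (𝒮 0)) ⟶ V, AlgebraicGeometry.Etale φ ∧ v ∈ Set.range φ ∧ φ ≫ g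 = AlgebraicGeometry.Spec.map (CommRingCat.ofHom (algebraMap k (𝒮 0)))) → Literature.AlgebraicGeometry.Resolution.Scheme.HasResolution V) → Summit.ResolutionOfSingularities.ResolutionOfSingularities.Theses.WeightedInvariant.WeightedThesis := by
  intro hH hBR p hp k _ _ _ X f hs hl hq hr
  obtain ⟨D⟩ := hH p hp
  haveI := hs; haveI := hl; haveI := hq; haveI := hr
  exact HypersurfaceTower.hasResolution_of_hypersurfaceDatum_field hp D
    (fun V g _ _ _ _ hV => hBR p hp k V g hV) X f

end Summit.ResolutionOfSingularities.ResolutionOfSingularities.Theorems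

end
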